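import Mathlib
import Summits.ValiantsHypothesis.ValiantsHypothesis.Theorems.NewtonUnitEquationsDissociatedUniformStubExposedGenericDirection
import Summits.ValiantsHypothesis.ValiantsHypothesis.Theorems.NewtonUnitEquationsNewtonTauWeakResidueDesignHull

/-!
# `NewtonUnitEquationsNewtonTauWeakWeightedLevelSetHull` — THEOREM W: hull vertices of weighted level sets

Registered stub `stub_weightedLevelSetHullOfNF` of line `binomial-normal-form` (crux `NewtonTauWeak`,
stmt-ValiantsHypothesis-5904, lead c6): the assembly of THEOREM W from the exchange normal form of weighted level
sets (piece W2, entering as the hypothesis `hNF`).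

Setting.  Items `j : Fin N` with weights `g j ∈ ℕ` and exponents `d j ∈ ℕ²` (coincidences allowed); the
weight-`v` level set of subset sums is `X_v = {Σ_{j ∈ J} d j : Σ_{j ∈ J} g j = v} ⊆ ℕ²`.  For a value vector
`c' : Fin N → ℝ` the *density rank* `rk c' j` of an item `j` is the number of items `j'` of larger density
(`c' j * g j' < c' j' * g j`, ties broken by the index), and the *canonical set* `canon c' k α β` is the rank
prefix `{rk c' j < k}` with the `α a` items of lowest density of each weight class `a` removed and the `β a`
non-prefix items of highest density of each weight class `a` added (`rk`, `canon` are parameters characterised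
by `hrk`, `hcanon`; all density comparisons are cross-multiplied, `c' x * g y < c' y * g x`).  The normal form
`hNF` says: every maximiser `J` of `Σ_J c' j` over `{Σ_J g j = v}` has the weight and the value of some
`canon c' k α β` with `k ≤ N`, `Σ_{a ≤ c} (α a + β a) ≤ 2 c` and `α a = β a = 0` for `a = 0` or `c < a`.
Claim: the convex hull of `X_v ⊆ ℝ²` has at most `(4 N² + 5) (N + 1) (2 c + 1)^{2 c}` extreme points.

Proof (the assembly of `stub_residueDesignHull`, Theorems/…ResidueDesignHull.lean, up to bookkeeping).
* (`WeightedLevelSetHullAux.extremePoint_eq_canon`)  An extreme point `e` of `conv X_v` is strictly exposed by a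
  direction `w` (`NewtonUnitEquationsDissociatedUniform.stub_exposedGenericDirection` with `T = ∅`); with the
  values `c' j = ⟨w, d j⟩` the height of a subset sum `Σ_J d j` is `Σ_J c' j`, so `e = Σ_{J₀} d j` for a
  maximiser `J₀` of `Σ_J c' j` over `{Σ_J g j = v}`, `hNF` provides `(k, α, β)` with `canon c' k α β` of weight
  `v` and the same value, and strict exposure forces `Σ_{canon c' k α β} d j = e`.
* (`WeightedLevelSetHullAux.canon_eq_of_signs`)  `canon c' k α β` depends on `c'` only through the signs of the
  `N * N` numbers `c' j' * g j - c' j * g j'`, i.e. through the sign vector at `w` of the linear functionals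
  `w ↦ ⟨w, g j • d j' - g j' • d j⟩` (pairs `(j', j)` enumerated by `finProdFinEquiv`); by
  `ResidueDesignHullAux.signvec_plane_count` at most `4 (N * N) + 5` sign vectors are realised.
* (`WeightedLevelSetHullAux.exists_lift_eq`)  The canonical set evaluates the parameters `α, β` only at the
  weights `g j ∈ [1, c]`, where they are bounded by `2 c` (a single term of the sum `Σ_{a ≤ c} (α a + β a) ≤ 2 c`),
  so it is unchanged when `α, β` are replaced by the extensions by zero of the vectors `(α (a + 1))_{a < c}`,
  `(β (a + 1))_{a < c} : Fin c → Fin (2 c + 1)`; and `k ∈ [0, N]`.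
* (`stub_weightedLevelSetHullOfNF`)  Hence the extreme points are images of quadruples (sign vector, `k`, `α'`,
  `β'`): at most `(4 (N * N) + 5) (N + 1) (2 c + 1)^c (2 c + 1)^c` of them.

Everything is folklore (planar convexity, arrangements on a line, counting); no named facts, no citations.
No `def`s: the functionals, the sign rank, the sign-canonical set and the zero extension are explicit lambda
terms, introduced as parameters characterised by equations.
-/

-- Sub = Summit single-conjunct layout: the duplicated namespace component is mandated by the tree.
set_option linter.dupNamespace false

noncomputable section

open scoped BigOperators

namespace Summit.ValiantsHypothesis.ValiantsHypothesis.Theorems.NewtonUnitEquationsNewtonTauWeak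

namespace WeightedLevelSetHullAux

/-- **The canonical set only depends on the sign vector.**  The density rank `rk c' j` and the canonical set
`canon c' k α β` (characterised by `hrk`, `hcanon`) compare the values `c'` only through the signs of the
numbers `c' j' * g j - c' j * g j'`: `c' j * g j' < c' j' * g j` iff the sign is `1`, `c' j' * g j < c' j * g j'`
iff it is `-1`, and the ties iff it is `0`.  Reading these signs from a vector `v : Fin (N * N) → SignType`
(pairs `(j', j)` via `finProdFinEquiv`), the rank is the displayed count `R j` and `canon c' k α β` is the
displayed set. [folklore] -/
theorem canon_eq_of_signs (N : ℕ) (g : Fin N → ℕ) (c' : Fin N → ℝ) (k : ℕ) (α β : ℕ → ℕ)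
    (rk : (Fin N → ℝ) → Fin N → ℕ)
    (hrk : ∀ c' j, rk c' j = (Finset.univ.filter fun j' : Fin N =>
        c' j * (g j' : ℝ) < c' j' * (g j : ℝ) ∨ (c' j' * (g j : ℝ) = c' j * (g j' : ℝ) ∧ j' < j)).card)
    (canon : (Fin N → ℝ) → ℕ → (ℕ → ℕ) → (ℕ → ℕ) → Finset (Fin N))
    (hcanon : ∀ c' k α β, canon c' k α β = Finset.univ.filter fun j : Fin N =>
        (rk c' j < k ∧ α (g j) ≤ (Finset.univ.filter fun j' : Fin N =>
            rk c' j' < k ∧ g j' = g j ∧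
              (c' j' * (g j : ℝ) < c' j * (g j' : ℝ) ∨ (c' j * (g j' : ℝ) = c' j' * (g j : ℝ) ∧ j < j'))).card) ∨
        (k ≤ rk c' j ∧ (Finset.univ.filter fun j' : Fin N =>
            k ≤ rk c' j' ∧ g j' = g j ∧
              (c' j * (g j' : ℝ) < c' j' * (g j : ℝ) ∨ (c' j' * (g j : ℝ) = c' j * (g j' : ℝ) ∧ j' < j))).card
            < β (g j)))
    (v : Fin (N * N) → SignType)
    (hvp : ∀ j' j, v (finProdFinEquiv (j', j)) = SignType.sign (c' j' * (g j : ℝ) - c' j * (g j' : ℝ)))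
    (R : Fin N → ℕ)
    (hR : ∀ j, R j = (Finset.univ.filter fun j' : Fin N =>
        v (finProdFinEquiv (j', j)) = 1 ∨ (v (finProdFinEquiv (j', j)) = 0 ∧ j' < j)).card) :
    canon c' k α β = Finset.univ.filter fun j : Fin N =>
        (R j < k ∧ α (g j) ≤ (Finset.univ.filter fun j' : Fin N =>
            R j' < k ∧ g j' = g j ∧
              (v (finProdFinEquiv (j', j)) = -1 ∨ (v (finProdFinEquiv (j, j')) = 0 ∧ j < j'))).card) ∨
        (k ≤ R j ∧ (Finset.univ.filter fun j' : Fin N =>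
            k ≤ R j' ∧ g j' = g j ∧
              (v (finProdFinEquiv (j', j)) = 1 ∨ (v (finProdFinEquiv (j', j)) = 0 ∧ j' < j))).card
            < β (g j)) := by
  -- the density rank is the sign rank
  have hRr : ∀ j, rk c' j = R j := fun j => by
    rw [hrk, hR]
    simp only [hvp, sign_eq_one_iff, sign_eq_zero_iff, sub_pos, sub_eq_zero]
  simp only [hcanon, hRr, hvp, sign_eq_one_iff, sign_eq_neg_one_iff, sign_eq_zero_iff, sub_pos, sub_neg,
    sub_eq_zero]

/-- **Zero extension of the class parameters.**  If `Σ_{a ≤ c} (α a + β a) ≤ 2 c`, then on `[1, c]` the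
parameters `α` and `β` agree with the extensions by zero (the map `L`, characterised by `hL`) of the vectors
`a ↦ α (a + 1)`, `a ↦ β (a + 1)`, `a < c`, whose entries are `< 2 c + 1`. [folklore] -/
theorem exists_lift_eq (c : ℕ) (α β : ℕ → ℕ) (hsum : ∑ a ∈ Finset.range (c + 1), (α a + β a) ≤ 2 * c)
    (L : (Fin c → Fin (2 * c + 1)) → ℕ → ℕ)
    (hL : ∀ γ a, L γ a = if h : 1 ≤ a ∧ a ≤ c then ((γ ⟨a - 1, by omega⟩ : Fin (2 * c + 1)) : ℕ) else 0) :
    ∃ α' β' : Fin c → Fin (2 * c + 1), ∀ a, 1 ≤ a → a ≤ c → L α' a = α a ∧ L β' a = β a := by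
  -- a single term is bounded by the sum
  have hle : ∀ i : Fin c, α (i + 1) + β (i + 1) ≤ 2 * c := fun i =>
    (Finset.single_le_sum (fun a _ => Nat.zero_le (α a + β a))
      (Finset.mem_range.2 (Nat.succ_lt_succ i.2))).trans hsum
  have hlift : ∀ γ : ℕ → ℕ, (∀ i : Fin c, γ (i + 1) ≤ 2 * c) →
      ∃ γ' : Fin c → Fin (2 * c + 1), ∀ a, 1 ≤ a → a ≤ c → L γ' a = γ a := by
    intro γ hγ
    refine ⟨fun i => ⟨γ (i + 1), Nat.lt_succ_of_le (hγ i)⟩, fun a h1 hc => ?_⟩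
    rw [hL, dif_pos ⟨h1, hc⟩]
    exact congr_arg γ (Nat.sub_add_cancel h1)
  obtain ⟨α', hα'⟩ := hlift α fun i => by have := hle i; omega
  obtain ⟨β', hβ'⟩ := hlift β fun i => by have := hle i; omega
  exact ⟨α', β', fun a h1 hc => ⟨hα' a h1 hc, hβ' a h1 hc⟩⟩

/-- **Every vertex is the point of a canonical set.**  Every extreme point `e` of the convex hull of
`X_v = {Σ_{j ∈ J} d j : Σ_{j ∈ J} g j = v}` is `Σ_{j ∈ canon c' k α β} d j` for the values `c' j = ⟨w, d j⟩`
of a strictly exposing direction `w` (`stub_exposedGenericDirection`) and parameters `(k, α, β)` as in the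
normal form `hNF`: `e = Σ_{J₀} d j` with `J₀` of weight `v` maximising `Σ_J c' j` among sets of weight `v`
(heights of subset sums are sums of values), the canonical set provided by `hNF` has weight `v` and the same
value, and a strictly exposed maximum is attained at `e` only. [folklore] -/
theorem extremePoint_eq_canon (N c v : ℕ) (g : Fin N → ℕ) (d : Fin N → (Fin 2 →₀ ℕ))
    (canon : (Fin N → ℝ) → ℕ → (ℕ → ℕ) → (ℕ → ℕ) → Finset (Fin N))
    (hNF : ∀ (c' : Fin N → ℝ) (J : Finset (Fin N)), ∑ j ∈ J, g j = v →
        (∀ J' : Finset (Fin N), ∑ j ∈ J', g j = v → ∑ j ∈ J', c' j ≤ ∑ j ∈ J, c' j) →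
        ∃ (k : ℕ) (α β : ℕ → ℕ), k ≤ N ∧ (∑ a ∈ Finset.range (c + 1), (α a + β a) ≤ 2 * c) ∧
          (∀ a, (a = 0 ∨ c < a) → α a = 0 ∧ β a = 0) ∧
          ∑ j ∈ canon c' k α β, g j = v ∧ ∑ j ∈ canon c' k α β, c' j = ∑ j ∈ J, c' j)
    (e : Fin 2 → ℝ)
    (he : e ∈ Set.extremePoints ℝ
      (convexHull ℝ ((fun e : Fin 2 →₀ ℕ => fun i : Fin 2 => ((e i : ℕ) : ℝ)) ''
        (((Finset.univ.filter fun J : Finset (Fin N) => ∑ j ∈ J, g j = v).image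
          fun J => ∑ j ∈ J, d j : Finset (Fin 2 →₀ ℕ)) : Set (Fin 2 →₀ ℕ))))) :
    ∃ (w : Fin 2 → ℝ) (c' : Fin N → ℝ) (k : ℕ) (α β : ℕ → ℕ),
      (∀ j, c' j = ∑ i, w i * ((d j i : ℕ) : ℝ)) ∧ k ≤ N ∧
      (∑ a ∈ Finset.range (c + 1), (α a + β a) ≤ 2 * c) ∧
      (∀ a, (a = 0 ∨ c < a) → α a = 0 ∧ β a = 0) ∧
      e = fun i => (((∑ j ∈ canon c' k α β, d j) i : ℕ) : ℝ) := by
  classical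
  obtain ⟨w, e₀, he₀X, rfl, hexp, -⟩ :=
    NewtonUnitEquationsDissociatedUniform.stub_exposedGenericDirection _ ∅ e he
  obtain ⟨c', hc⟩ : ∃ c' : Fin N → ℝ, ∀ j, c' j = ∑ i, w i * ((d j i : ℕ) : ℝ) := ⟨_, fun _ => rfl⟩
  -- heights of subset sums are sums of values
  have hlin : ∀ J : Finset (Fin N), ∑ i, w i * (((∑ j ∈ J, d j) i : ℕ) : ℝ) = ∑ j ∈ J, c' j := by
    intro J
    simp only [Finsupp.finsetSum_apply, Nat.cast_sum, Finset.mul_sum, hc]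
    exact Finset.sum_comm
  -- the exposed vertex is a subset sum of weight `v` and maximal value
  obtain ⟨J₀, hJ₀, rfl⟩ := Finset.mem_image.1 he₀X
  have hJ₀v : ∑ j ∈ J₀, g j = v := (Finset.mem_filter.1 hJ₀).2
  have hmax : ∀ J' : Finset (Fin N), ∑ j ∈ J', g j = v → ∑ j ∈ J', c' j ≤ ∑ j ∈ J₀, c' j := by
    intro J' hJ'
    by_cases heq : ∑ j ∈ J', d j = ∑ j ∈ J₀, d j
    · exact le_of_eq (by rw [← hlin, ← hlin, heq])
    · have hlt := hexp _ (Finset.mem_image.2 ⟨J', Finset.mem_filter.2 ⟨Finset.mem_univ _, hJ'⟩, rfl⟩) heq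
      rw [hlin, hlin] at hlt
      exact hlt.le
  -- a maximiser's point is the vertex, by strict exposure
  have huniq : ∀ K : Finset (Fin N), ∑ j ∈ K, g j = v → ∑ j ∈ K, c' j = ∑ j ∈ J₀, c' j →
      (fun i : Fin 2 => (((∑ j ∈ J₀, d j) i : ℕ) : ℝ)) = fun i => (((∑ j ∈ K, d j) i : ℕ) : ℝ) := by
    intro K hK hKsum
    by_contra hne
    have hne' : ∑ j ∈ K, d j ≠ ∑ j ∈ J₀, d j := fun h => hne (by rw [h])
    have hlt := hexp _ (Finset.mem_image.2 ⟨K, Finset.mem_filter.2 ⟨Finset.mem_univ _, hK⟩, rfl⟩) hne'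
    rw [hlin, hlin, hKsum] at hlt
    exact lt_irrefl _ hlt
  obtain ⟨k, α, β, hk, hsum, hvan, hKv, hKsum⟩ := hNF c' J₀ hJ₀v hmax
  exact ⟨w, c', k, α, β, hc, hk, hsum, hvan, huniq _ hKv hKsum⟩

end WeightedLevelSetHullAux

/-- **THEOREM W from the normal form (hull vertices of weighted level sets of subset sums are polynomial),
registered stub `stub_weightedLevelSetHullOfNF` of line `binomial-normal-form`.**  For weights `1 ≤ g j ≤ c`
and exponents `d j ∈ ℕ²` (`j : Fin N`, coincidences allowed), granted the exchange normal form `hNF` of the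
maximisers of linear functions over `{J : Σ_J g j = v}` in terms of the canonical sets `canon c' k α β`
(`hrk`, `hcanon`), the convex hull of `X_v = {Σ_{j ∈ J} d j : Σ_{j ∈ J} g j = v}` has at most
`(4 (N * N) + 5) (N + 1) (2 c + 1) ^ (2 c)` extreme points.  Proof: every extreme point is
`Σ_{j ∈ canon c' k α β} d j` for the values `c'` of a strictly exposing direction `w`
(`WeightedLevelSetHullAux.extremePoint_eq_canon`); the canonical set is determined by `(k, α, β)` and the sign
vector of the `N * N` functionals `⟨w, g j • d j' - g j' • d j⟩` (`WeightedLevelSetHullAux.canon_eq_of_signs`)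
— at most `4 (N * N) + 5` of them (`ResidueDesignHullAux.signvec_plane_count`) —, `k ≤ N`, and `α`, `β` may be
replaced by the zero extensions of vectors `Fin c → Fin (2 c + 1)` (`WeightedLevelSetHullAux.exists_lift_eq`), as
they are only evaluated at weights `g j ∈ [1, c]`. [folklore] -/
theorem stub_weightedLevelSetHullOfNF (N c v : ℕ) (g : Fin N → ℕ) (hg : ∀ j, 1 ≤ g j ∧ g j ≤ c)
    (d : Fin N → (Fin 2 →₀ ℕ))
    (rk : (Fin N → ℝ) → Fin N → ℕ)
    (hrk : ∀ c' j, rk c' j = (Finset.univ.filter fun j' : Fin N =>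
        c' j * (g j' : ℝ) < c' j' * (g j : ℝ) ∨ (c' j' * (g j : ℝ) = c' j * (g j' : ℝ) ∧ j' < j)).card)
    (canon : (Fin N → ℝ) → ℕ → (ℕ → ℕ) → (ℕ → ℕ) → Finset (Fin N))
    (hcanon : ∀ c' k α β, canon c' k α β = Finset.univ.filter fun j : Fin N =>
        (rk c' j < k ∧ α (g j) ≤ (Finset.univ.filter fun j' : Fin N =>
            rk c' j' < k ∧ g j' = g j ∧
              (c' j' * (g j : ℝ) < c' j * (g j' : ℝ) ∨ (c' j * (g j' : ℝ) = c' j' * (g j : ℝ) ∧ j < j'))).card) ∨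
        (k ≤ rk c' j ∧ (Finset.univ.filter fun j' : Fin N =>
            k ≤ rk c' j' ∧ g j' = g j ∧
              (c' j * (g j' : ℝ) < c' j' * (g j : ℝ) ∨ (c' j' * (g j : ℝ) = c' j * (g j' : ℝ) ∧ j' < j))).card
            < β (g j)))
    (hNF : ∀ (c' : Fin N → ℝ) (J : Finset (Fin N)), ∑ j ∈ J, g j = v →
        (∀ J' : Finset (Fin N), ∑ j ∈ J', g j = v → ∑ j ∈ J', c' j ≤ ∑ j ∈ J, c' j) →
        ∃ (k : ℕ) (α β : ℕ → ℕ), k ≤ N ∧ (∑ a ∈ Finset.range (c + 1), (α a + β a) ≤ 2 * c) ∧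
          (∀ a, (a = 0 ∨ c < a) → α a = 0 ∧ β a = 0) ∧
          ∑ j ∈ canon c' k α β, g j = v ∧ ∑ j ∈ canon c' k α β, c' j = ∑ j ∈ J, c' j) :
    (Set.extremePoints ℝ (convexHull ℝ ((fun e : Fin 2 →₀ ℕ => fun i : Fin 2 => ((e i : ℕ) : ℝ)) ''
      (((Finset.univ.filter fun J : Finset (Fin N) => ∑ j ∈ J, g j = v).image
        fun J => ∑ j ∈ J, d j : Finset (Fin 2 →₀ ℕ)) : Set (Fin 2 →₀ ℕ))))).ncard ≤
      (4 * (N * N) + 5) * (N + 1) * (2 * c + 1) ^ (2 * c) := by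
  classical
  -- the `N * N` linear functionals `w ↦ ⟨w, g j • d j' - g j' • d j⟩`, pairs `(j', j)` via `finProdFinEquiv`
  obtain ⟨u, hup⟩ : ∃ u : Fin (N * N) → Fin 2 → ℝ, ∀ j' j i, u (finProdFinEquiv (j', j)) i =
      (g j : ℝ) * ((d j' i : ℕ) : ℝ) - (g j' : ℝ) * ((d j i : ℕ) : ℝ) := by
    refine ⟨fun p i => (g (finProdFinEquiv.symm p).2 : ℝ) * ((d (finProdFinEquiv.symm p).1 i : ℕ) : ℝ) -
        (g (finProdFinEquiv.symm p).1 : ℝ) * ((d (finProdFinEquiv.symm p).2 i : ℕ) : ℝ), fun j' j i => ?_⟩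
    simp only [Equiv.symm_apply_apply]
  -- the rank and the canonical set read off from a sign vector and the parameters
  obtain ⟨R, hR⟩ : ∃ R : (Fin (N * N) → SignType) → Fin N → ℕ, ∀ σ j, R σ j =
      (Finset.univ.filter fun j' : Fin N =>
        σ (finProdFinEquiv (j', j)) = 1 ∨ (σ (finProdFinEquiv (j', j)) = 0 ∧ j' < j)).card :=
    ⟨_, fun _ _ => rfl⟩
  obtain ⟨F, hF⟩ :
      ∃ F : (Fin (N * N) → SignType) → ℕ → (ℕ → ℕ) → (ℕ → ℕ) → Finset (Fin N), ∀ σ k α β,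
      F σ k α β = Finset.univ.filter fun j : Fin N =>
        (R σ j < k ∧ α (g j) ≤ (Finset.univ.filter fun j' : Fin N =>
            R σ j' < k ∧ g j' = g j ∧
              (σ (finProdFinEquiv (j', j)) = -1 ∨ (σ (finProdFinEquiv (j, j')) = 0 ∧ j < j'))).card) ∨
        (k ≤ R σ j ∧ (Finset.univ.filter fun j' : Fin N =>
            k ≤ R σ j' ∧ g j' = g j ∧
              (σ (finProdFinEquiv (j', j)) = 1 ∨ (σ (finProdFinEquiv (j', j)) = 0 ∧ j' < j))).card
            < β (g j)) :=
    ⟨_, fun _ _ _ _ => rfl⟩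
  -- the zero extension `ℕ → ℕ` of a vector `Fin c → Fin (2 * c + 1)` indexed by `[1, c]`
  obtain ⟨L, hL⟩ : ∃ L : (Fin c → Fin (2 * c + 1)) → ℕ → ℕ, ∀ γ a,
      L γ a = if h : 1 ≤ a ∧ a ≤ c then ((γ ⟨a - 1, by omega⟩ : Fin (2 * c + 1)) : ℕ) else 0 :=
    ⟨_, fun _ _ => rfl⟩
  -- the realised sign vectors
  obtain ⟨V, hV⟩ : ∃ V : Set (Fin (N * N) → SignType),
      V = {v | ∃ w : Fin 2 → ℝ, v = fun m => SignType.sign (∑ i, w i * u m i)} := ⟨_, rfl⟩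
  have hVcard : V.ncard ≤ 4 * (N * N) + 5 := by
    rw [hV]
    exact ResidueDesignHullAux.signvec_plane_count _ u
  -- every vertex is the point of the canonical set of a realised sign vector and parameters in the box
  refine (Set.ncard_le_ncard (t :=
    (fun p : (Fin (N * N) → SignType) × (ℕ × ((Fin c → Fin (2 * c + 1)) × (Fin c → Fin (2 * c + 1)))) =>
      fun i : Fin 2 => (((∑ j ∈ F p.1 p.2.1 (L p.2.2.1) (L p.2.2.2), d j) i : ℕ) : ℝ)) ''
        (V ×ˢ (((Finset.range (N + 1) : Finset ℕ) : Set ℕ) ×ˢ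
          ((Set.univ : Set (Fin c → Fin (2 * c + 1))) ×ˢ (Set.univ : Set (Fin c → Fin (2 * c + 1))))))) ?_).trans
    ?_
  · intro e he
    obtain ⟨w, c', k, α, β, hc, hk, hsum, -, he_eq⟩ :=
      WeightedLevelSetHullAux.extremePoint_eq_canon N c v g d canon hNF e he
    obtain ⟨α', β', hαβ⟩ := WeightedLevelSetHullAux.exists_lift_eq c α β hsum L hL
    -- the canonical set evaluates the class parameters only at the weights `g j ∈ [1, c]`
    have hcanonL : canon c' k (L α') (L β') = canon c' k α β := by
      rw [hcanon, hcanon]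
      refine Finset.filter_congr fun j _ => ?_
      rw [(hαβ (g j) (hg j).1 (hg j).2).1, (hαβ (g j) (hg j).1 (hg j).2).2]
    -- the sign vector at `w` records the signs of `c' j' * g j - c' j * g j'`
    have hvp : ∀ j' j, SignType.sign (∑ i, w i * u (finProdFinEquiv (j', j)) i) =
        SignType.sign (c' j' * (g j : ℝ) - c' j * (g j' : ℝ)) := by
      intro j' j
      congr 1
      rw [hc, hc, Finset.sum_mul, Finset.sum_mul, ← Finset.sum_sub_distrib]
      exact Finset.sum_congr rfl fun i _ => by rw [hup]; ring
    have hAeq := WeightedLevelSetHullAux.canon_eq_of_signs N g c' k (L α') (L β') rk hrk canon hcanon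
      (fun m => SignType.sign (∑ i, w i * u m i)) hvp (R fun m => SignType.sign (∑ i, w i * u m i)) (hR _)
    refine ⟨((fun m => SignType.sign (∑ i, w i * u m i)), k, α', β'),
      Set.mk_mem_prod (by rw [hV]; exact ⟨w, rfl⟩)
        (Set.mk_mem_prod (Finset.mem_coe.2 (Finset.mem_range.2 (Nat.lt_succ_of_le hk)))
          (Set.mk_mem_prod (Set.mem_univ _) (Set.mem_univ _))), ?_⟩
    dsimp only
    rw [hF, ← hAeq, hcanonL]
    exact he_eq.symm
  -- count
  · calc _ ≤ (V ×ˢ (((Finset.range (N + 1) : Finset ℕ) : Set ℕ) ×ˢ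
          ((Set.univ : Set (Fin c → Fin (2 * c + 1))) ×ˢ (Set.univ : Set (Fin c → Fin (2 * c + 1)))))).ncard :=
          Set.ncard_image_le
      _ = V.ncard * ((N + 1) * ((2 * c + 1) ^ c * (2 * c + 1) ^ c)) := by
          simp only [Set.ncard_prod, Set.ncard_coe_finset, Finset.card_range, Set.ncard_univ, Nat.card_fun,
            Nat.card_fin]
      _ ≤ (4 * (N * N) + 5) * ((N + 1) * ((2 * c + 1) ^ c * (2 * c + 1) ^ c)) :=
          Nat.mul_le_mul_right _ hVcard
      _ = (4 * (N * N) + 5) * (N + 1) * (2 * c + 1) ^ (2 * c) := by ring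

end Summit.ValiantsHypothesis.ValiantsHypothesis.Theorems.NewtonUnitEquationsNewtonTauWeak

end
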